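import Summits.ABC.ABC.Theorems.TwistAmplificationSharpModerateLawUnitPlaneFlat6Defs
import Summits.ABC.ABC.Theorems.TwistAmplificationSharpModerateLawCuspDispersionTwDefs
import Summits.ABC.ABC.Theorems.TwistAmplificationSharpModerateLawSyzygyTransfer

/-!
# Crux `TwistAmplification.SharpModerateLaw` (stmt-ABC-1975), line `unit-plane-conic-two-torsion`:
the Hall-corner law implies the sibling line's twist-aware Hall regime law

Cross-line identification for the open stub `stub_cornerHall : CornerHallLaw6` (`= LawWithConeE CornerHallTw 1`,
objects of `…SharpModerateLawUnitPlaneFlat6Defs.lean`): it implies the registered-then-open Hall stub of the sibling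
line `deep-moduli-cusp-dispersion`, `LawOn HallRegimeTw` (`…SharpModerateLawCuspDispersionTwDefs.lean`). Main theorem
(registered sub-goal of stmt-ABC-1975): `lawOn_hallRegimeTw_of_cornerHallLaw6 : CornerHallLaw6 → LawOn HallRegimeTw`.

Proof. TWIST-COMPATIBLE DICTIONARY (`exists_twistData`): for a pair `x = (c₄, c₆)` with a twist divisor `d`
(`d² ∣ c₄`, `d³ ∣ c₆`) write `x = (d²a, d³b)` and take the landed datum `(F, q₀)` of `x₀ = (a, b)`
(`exists_indexFormData`, `…SyzygyTransfer.lean`: `F` maximal, `H_F(q₀) = 9a`, `G_F(q₀) = −54b`,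
`Disc F·F(q₀)² = 108(a³ − b²)`); by homogeneity (`H_F`, `G_F`, `F` of degrees `2, 3, 3`: `FewDeepSlice.hessAt_smul'`,
`covAt_twist`, `FewDeepSlice.eval_smul'`) the datum `Q = d·q₀`
satisfies the same three equations for `x`, and `d ∣ gcd Q`. POPULATION (`cornerHallTw_of_twistData`): with
`g = gcd Q ≥ d` and `m = |F(Q/g)|`, `|Disc F|·m²·g⁶ = |Disc F·F(Q)²| = 108|c₄³ − c₆²|` (`disc_primValue_gcd`), so the
Hall bound `|c₄³ − c₆²| ≤ 1728·√Y·d³` of `HallRegimeTw` gives `|Disc F|·m²·g³ ≤ 186624·√Y ≤ 432·√(2·186624·L)` for every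
shell level `L ≥ Y/2`, i.e. `CornerHallTw` at the index-form level `186624·L`. SHELLS (`cuspShell_or_of_mem_cuspSetD`):
a pair of `cuspSetD X Y` (`M⁺ ∈ (Y/2, Y]`, `N* ≤ X`) lies in `cuspShell X (Y/2)` or in `cuspShell X Y`
(`Mcusp = M⁺` as `1728 ∣ c₄³ − c₆²`; `N5cusp ≤ N*`, a sub-product), so the datum lies in `ifShell F X (186624·L)`,
`L ∈ {Y/2, Y}` (`mem_ifShell_of_data`). COUNT (`ncard_le_totalCount_of_data`, the injection pattern of
`ncard_cuspShell_le` along data functions; `x` is read off from `H_F(Q), G_F(Q)`):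
`#{x ∈ cuspSetD X Y : HallRegimeTw Y x} ≤ totalCount (CornerHallTw ε') X (93312Y) + totalCount (CornerHallTw ε') X (186624Y)`.
CONE (`level_bound`): the law at `σ` and `ε' = ε/(1 + σ)`: `X³ ≤ 8Y ≤ 2Y'`, `Y' ≤ 186624·X^σ`, `Y'^{−1/6} ≤ Y^{−1/6}`,
`(X·Y')^{ε'} ≤ (186624·X^{1+σ})^{ε'} = 186624^{ε'}·X^ε`; constant `2·max(C₀, 0)·186624^{ε'}`.
The stub `stub_cornerHall` itself stays open (calibrated below the √-barrier in `…CornerHallCalibration.lean`).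
-/

noncomputable section

-- the mandated summit namespace `Summit.ABC.ABC` (summit = problem) trips the duplicate-namespace linter
set_option linter.dupNamespace false

namespace Summit.ABC.ABC.Theorems.SharpModerateLaw.UnitPlane

open Literature.NumberTheory.CubicFields
open Summit.ABC.ABC.Theorems.SharpModerateLaw.CuspDispersion (HallRegimeTw LawOn cuspSetD Nstar sepSet_finite)
open scoped BigOperators

/-! ## 1. Homogeneity and the twist-compatible dictionary step -/

/-- The cubic covariant is homogeneous of degree `3`: `G_F(d·q) = d³·G_F(q)` (the degree-`2` and degree-`3`
homogeneity of `H_F` and `F` are the landed `FewDeepSlice.hessAt_smul'`, `FewDeepSlice.eval_smul'`). -/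
theorem covAt_twist (F : BinaryCubic ℤ) (d u v : ℤ) : covAt F (d * u) (d * v) = d ^ 3 * covAt F u v := by
  simp only [covAt]; ring

/-- **Twist-compatible dictionary step.** For `c₄³ ≠ c₆²` and `x = (c₄, c₆)` in the twist-aware Hall regime at
level `Y` there are a MAXIMAL orbit representative `F = orbitRep O`, a datum `q` with `H_F(q) = 9c₄`, `G_F(q) = −54c₆`,
`Disc F·F(q)² = 108(c₄³ − c₆²)`, and a twist divisor `d ∣ q` carrying the Hall bound `|c₄³ − c₆²| ≤ 1728·√Y·d³`
(the datum of `(c₄/d², c₆/d³)` from `exists_indexFormData`, multiplied by `d`; hypotheses inside for a total choice). -/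
theorem exists_twistData (Y : ℝ) (x : ℤ × ℤ) :
    ∃ D : ℤ, ∃ O : orbitsOfDisc D, ∃ q : ℤ × ℤ, x.1 ^ 3 ≠ x.2 ^ 2 → HallRegimeTw Y x →
      RingOfForm.IsMaximal (orbitRep O) ∧
      hessAt (orbitRep O) q.1 q.2 = 9 * x.1 ∧ covAt (orbitRep O) q.1 q.2 = -54 * x.2 ∧
      (orbitRep O).disc * (orbitRep O).eval q.1 q.2 ^ 2 = 108 * (x.1 ^ 3 - x.2 ^ 2) ∧
      ∃ d : ℕ, (d : ℤ) ∣ q.1 ∧ (d : ℤ) ∣ q.2 ∧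
        ((|x.1 ^ 3 - x.2 ^ 2| : ℤ) : ℝ) ≤ 1728 * Y ^ (1 / 2 : ℝ) * (d : ℝ) ^ 3 := by
  by_cases hx : x.1 ^ 3 ≠ x.2 ^ 2 ∧ HallRegimeTw Y x
  swap
  · exact ⟨_, ⟨BinaryCubic.gl2zOrbit ⟨1, 0, 0, 0⟩, _, rfl, rfl⟩, (0, 0), fun h1 h2 => absurd ⟨h1, h2⟩ hx⟩
  obtain ⟨hne, d, ⟨a, ha⟩, ⟨b, hb⟩, hbound⟩ := hx
  obtain ⟨D, O, q₀, hspec⟩ := exists_indexFormData (a, b)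
  have hne₀ : (a, b).1 ^ 3 ≠ (a, b).2 ^ 2 := by
    intro h
    dsimp only at h
    apply hne
    rw [ha, hb]
    linear_combination ((d : ℤ) ^ 6) * h
  obtain ⟨hmax, hH, hG, hDF⟩ := hspec hne₀
  dsimp only at hH hG hDF
  refine ⟨D, O, ((d : ℤ) * q₀.1, (d : ℤ) * q₀.2), fun _ _ =>
    ⟨hmax, ?_, ?_, ?_, d, ⟨q₀.1, rfl⟩, ⟨q₀.2, rfl⟩, hbound⟩⟩
  · rw [FewDeepSlice.hessAt_smul', hH, ha]; ring
  · rw [covAt_twist, hG, hb]; ring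
  · rw [FewDeepSlice.eval_smul', ha, hb]; linear_combination ((d : ℤ) ^ 6) * hDF

/-! ## 2. The population: a twist-compatible Hall datum is in the Hall corner -/

/-- `|Disc F|·m²·g⁶ = |Disc F·F(q)²|` for `m = primValue F q = |F(q/g)|`, `g = gcd q` (homogeneity of `F`). -/
theorem disc_primValue_gcd (F : BinaryCubic ℤ) (q : ℤ × ℤ) :
    F.disc.natAbs * primValue F q ^ 2 * Int.gcd q.1 q.2 ^ 6 = (F.disc * F.eval q.1 q.2 ^ 2).natAbs := by
  obtain ⟨y, z⟩ := q
  unfold primValue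
  dsimp only
  rcases Nat.eq_zero_or_pos (Int.gcd y z) with h0 | h0
  · obtain ⟨h1, h2⟩ := Int.gcd_eq_zero_iff.mp h0
    subst h1 h2
    simp [BinaryCubic.eval]
  obtain ⟨g, u, v, hg, hcop, hy, hz⟩ := Int.exists_gcd_one' h0
  subst hy hz
  have hgZ : (g : ℤ) ≠ 0 := by exact_mod_cast hg.ne'
  have hgcd : Int.gcd (u * g) (v * g) = g := by rw [Int.gcd_mul_right, hcop, Int.natAbs_natCast, one_mul]
  rw [hgcd, Int.mul_ediv_cancel _ hgZ, Int.mul_ediv_cancel _ hgZ,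
    show F.eval (u * g) (v * g) = (g : ℤ) ^ 3 * F.eval u v by simp only [BinaryCubic.eval]; ring,
    Int.natAbs_mul, Int.natAbs_pow, Int.natAbs_mul, Int.natAbs_pow, Int.natAbs_natCast]
  ring

/-- **Population.** A datum `(F, q)` of `x = (c₄, c₆)` (`Disc F·F(q)² = 108(c₄³ − c₆²) ≠ 0`) with a divisor `d ∣ q`
carrying the Hall bound `|c₄³ − c₆²| ≤ 1728·√Y·d³` lies in the Hall corner `CornerHallTw` at every index-form level
`186624·L` with `Y ≤ 2L`: `|Disc F|·m²·g³ = 108|c₄³ − c₆²|/g³ ≤ 186624·√Y·(d/g)³ ≤ 186624·√Y ≤ 186624·√(2L) =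
432·√(2·186624·L)` (`d ≤ g` as `d ∣ g ≥ 1`). -/
theorem cornerHallTw_of_twistData {Y L : ℝ} (hL : Y ≤ 2 * L) {x : ℤ × ℤ} (hne : x.1 ^ 3 ≠ x.2 ^ 2)
    {F : BinaryCubic ℤ} {q : ℤ × ℤ} (hDF : F.disc * F.eval q.1 q.2 ^ 2 = 108 * (x.1 ^ 3 - x.2 ^ 2))
    {d : ℕ} (hd1 : (d : ℤ) ∣ q.1) (hd2 : (d : ℤ) ∣ q.2)
    (hb : ((|x.1 ^ 3 - x.2 ^ 2| : ℤ) : ℝ) ≤ 1728 * Y ^ (1 / 2 : ℝ) * (d : ℝ) ^ 3) (ε X : ℝ) :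
    CornerHallTw ε X (186624 * L) F q := by
  unfold CornerHallTw
  -- the content `g ≥ 1` and `d ≤ g`
  have hDf : F.disc * F.eval q.1 q.2 ^ 2 ≠ 0 := by
    rw [hDF]; exact mul_ne_zero (by norm_num) (sub_ne_zero.mpr hne)
  have hg0 : 0 < Int.gcd q.1 q.2 := by
    refine Nat.pos_of_ne_zero fun h => ?_
    obtain ⟨h1, h2⟩ := Int.gcd_eq_zero_iff.mp h
    apply right_ne_zero_of_mul hDf
    rw [h1, h2]; simp [BinaryCubic.eval]
  have hdg : d ≤ Int.gcd q.1 q.2 := Nat.le_of_dvd hg0 (Int.dvd_gcd hd1 hd2)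
  have hdG : (d : ℝ) ≤ (Int.gcd q.1 q.2 : ℝ) := by exact_mod_cast hdg
  have hd0 : (0 : ℝ) ≤ d := Nat.cast_nonneg d
  -- `|Disc F|·m²·g⁶ = 108|c₄³ − c₆²|`
  have hid : (F.disc.natAbs : ℝ) * (primValue F q : ℝ) ^ 2 * (Int.gcd q.1 q.2 : ℝ) ^ 6 =
      108 * (((|x.1 ^ 3 - x.2 ^ 2| : ℤ)) : ℝ) := by
    have h := congrArg (fun n : ℕ => (n : ℝ)) (disc_primValue_gcd F q)
    simp only [Nat.cast_mul, Nat.cast_pow] at h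
    rw [h, hDF, Nat.cast_natAbs, abs_mul, abs_of_pos (by norm_num : (0 : ℤ) < 108)]
    push_cast; ring
  -- `|Disc F|·m²·g³ ≤ 186624·√Y`
  have hS : Y ^ (1 / 2 : ℝ) = Real.sqrt Y := (Real.sqrt_eq_rpow Y).symm
  rw [hS] at hb
  have hsq0 : 0 ≤ Real.sqrt Y := Real.sqrt_nonneg Y
  have hmain : (F.disc.natAbs : ℝ) * (primValue F q : ℝ) ^ 2 * (Int.gcd q.1 q.2 : ℝ) ^ 3 ≤ 186624 * Real.sqrt Y := by
    have hd3 : (d : ℝ) ^ 3 ≤ (Int.gcd q.1 q.2 : ℝ) ^ 3 := pow_le_pow_left₀ hd0 hdG 3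
    have h1 : (F.disc.natAbs : ℝ) * (primValue F q : ℝ) ^ 2 * (Int.gcd q.1 q.2 : ℝ) ^ 3 * (Int.gcd q.1 q.2 : ℝ) ^ 3 ≤
        186624 * Real.sqrt Y * (Int.gcd q.1 q.2 : ℝ) ^ 3 := by
      calc (F.disc.natAbs : ℝ) * (primValue F q : ℝ) ^ 2 * (Int.gcd q.1 q.2 : ℝ) ^ 3 * (Int.gcd q.1 q.2 : ℝ) ^ 3
          = 108 * (((|x.1 ^ 3 - x.2 ^ 2| : ℤ)) : ℝ) := by rw [← hid]; ring
        _ ≤ 108 * (1728 * Real.sqrt Y * (d : ℝ) ^ 3) := by linarith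
        _ ≤ 108 * (1728 * Real.sqrt Y * (Int.gcd q.1 q.2 : ℝ) ^ 3) := by
            have := mul_le_mul_of_nonneg_left hd3 (by positivity : (0 : ℝ) ≤ 1728 * Real.sqrt Y)
            linarith
        _ = 186624 * Real.sqrt Y * (Int.gcd q.1 q.2 : ℝ) ^ 3 := by ring
    have hG3 : 0 < (Int.gcd q.1 q.2 : ℝ) ^ 3 := by
      have : (0 : ℝ) < Int.gcd q.1 q.2 := by exact_mod_cast hg0
      positivity
    exact le_of_mul_le_mul_right h1 hG3
  -- `186624·√Y ≤ 186624·√(2L) = 432·√(2·186624·L)`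
  have hsqrt : Real.sqrt Y ≤ Real.sqrt (2 * L) := Real.sqrt_le_sqrt hL
  have hR : 432 * Real.sqrt (2 * (186624 * L)) = 186624 * Real.sqrt (2 * L) := by
    rw [show (2 : ℝ) * (186624 * L) = (432 * 432) * (2 * L) by ring, Real.sqrt_mul (by norm_num) (2 * L),
      Real.sqrt_mul_self (by norm_num)]
    ring
  calc (F.disc.natAbs : ℝ) * (primValue F q : ℝ) ^ 2 * (Int.gcd q.1 q.2 : ℝ) ^ 3 ≤ 186624 * Real.sqrt Y := hmain
    _ ≤ 186624 * Real.sqrt (2 * L) := by linarith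
    _ = 432 * Real.sqrt (2 * (186624 * L)) := hR.symm

/-! ## 3. The shells: `cuspSetD X Y ⊆ cuspShell X (Y/2) ∪ cuspShell X Y` -/

/-- `N5cusp ≤ N*`: the conductor proxy away from `6` is the sub-product of `N*` over the primes `≥ 5`. -/
theorem n5cusp_le_nstar (x : ℤ × ℤ) : N5cusp x ≤ Nstar x := by
  unfold N5cusp Nstar
  refine Finset.prod_le_prod_of_subset_of_one_le' (Finset.filter_subset _ _) fun p hp _ => ?_
  have h1 : 1 ≤ p := (Nat.prime_of_mem_primeFactors hp).one_lt.le
  split_ifs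
  · exact Nat.one_le_pow _ _ h1
  · exact h1

/-- On `1728 ∣ c₄³ − c₆²`: `Mcusp (c₄, c₆) = max(|c₄|³, |c₄³ − c₆²|/1728) = M⁺` (as reals). -/
theorem cast_mcusp_eq_max {x : ℤ × ℤ} (h1728 : (1728 : ℤ) ∣ x.1 ^ 3 - x.2 ^ 2) :
    (Mcusp x : ℝ) = max (((|x.1| ^ 3 : ℤ)) : ℝ) ((((|x.1 ^ 3 - x.2 ^ 2| : ℤ)) : ℝ) / 1728) := by
  obtain ⟨Δ, hΔ⟩ := h1728
  have hdiv : (x.1 ^ 3 - x.2 ^ 2) / 1728 = Δ := by rw [hΔ]; exact Int.mul_ediv_cancel_left _ (by norm_num)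
  unfold Mcusp
  rw [hdiv, hΔ, Nat.cast_max, Nat.cast_pow, Nat.cast_natAbs, Nat.cast_natAbs, max_comm]
  push_cast
  rw [abs_mul, abs_of_pos (by norm_num : (0 : ℝ) < 1728)]
  congr 1
  ring

/-- **Shells.** A pair of the dyadic cusp set `cuspSetD X Y` (`M⁺ ∈ (Y/2, Y]`, `N* ≤ X`) lies in the cusp shell of
level `Y/2` (when `M⁺ < Y`) or of level `Y` (when `M⁺ = Y`). -/
theorem cuspShell_or_of_mem_cuspSetD {X Y : ℝ} {x : ℤ × ℤ} (hx : x ∈ cuspSetD X Y) :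
    x ∈ cuspShell X (Y / 2) ∨ x ∈ cuspShell X Y := by
  obtain ⟨h1, h2, h3, h1728, hTF, hc4, hΔ, hlow, hN⟩ := hx
  have hM := cast_mcusp_eq_max h1728
  have hN5 : (N5cusp x : ℝ) ≤ X := le_trans (by exact_mod_cast n5cusp_le_nstar x) hN
  have hMle : (Mcusp x : ℝ) ≤ Y := by
    rw [hM]; exact max_le hc4 (by rw [div_le_iff₀ (by norm_num : (0 : ℝ) < 1728)]; linarith)
  have hMgt : Y < 2 * (Mcusp x : ℝ) := by rw [hM]; exact hlow
  rcases hMle.lt_or_eq with hlt | heq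
  · exact Or.inl ⟨h1, h2, h3, h1728, hTF, by linarith, by linarith, hN5⟩
  · exact Or.inr ⟨h1, h2, h3, h1728, hTF, heq.ge, by linarith, hN5⟩

/-! ## 4. The dictionary injection along data functions -/

/-- The counted `P`-slice of the shell of an orbit representative of discriminant `D ≠ 0` is finite. -/
private theorem shellSetP_finite {D : ℤ} (hD : D ≠ 0) (O : orbitsOfDisc D)
    (P : ℝ → ℝ → BinaryCubic ℤ → ℤ × ℤ → Prop) (X Y : ℝ) :
    {q : ℤ × ℤ | RingOfForm.IsMaximal (orbitRep O) ∧ q ∈ ifShell (orbitRep O) X Y ∧ P X Y (orbitRep O) q}.Finite := by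
  refine (finite_mplus_le (orbitRep O) (by rw [(orbitRep_spec O).2]; exact hD) ⌈2 * Y⌉₊).subset ?_
  rintro q ⟨-, hq, -⟩
  exact_mod_cast (show (Mplus (orbitRep O) q : ℝ) ≤ ⌈2 * Y⌉₊ from (le_of_lt hq.2.2.2.2.2.1).trans (Nat.le_ceil _))

/-- **The dictionary injection along data functions** (the pattern of `ncard_cuspShell_le`, `…SyzygyTransfer.lean`):
if data functions `x ↦ (D x, O x, q x)` attach to every `x = (c₄, c₆)` of a set `S ⊆ cuspShell X L` a MAXIMAL orbit
representative `F = orbitRep (O x)` and a datum with `H_F(q) = 9c₄`, `G_F(q) = −54c₆`, `Disc F·F(q)² = 108(c₄³ − c₆²)`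
satisfying `P` at `(X, 186624·L)`, then `#S ≤ totalCount P X (186624·L)`: the datum lies in `ifShell F X (186624·L)`
(`mem_ifShell_of_data`) and `x ↦ (D x, O x, q x)` is injective on `S` (`x` is read off from `H_F(q), G_F(q)`). -/
theorem ncard_le_totalCount_of_data (S : Set (ℤ × ℤ)) (P : ℝ → ℝ → BinaryCubic ℤ → ℤ × ℤ → Prop) (X L : ℝ)
    (D : ℤ × ℤ → ℤ) (O : ∀ x, orbitsOfDisc (D x)) (q : ℤ × ℤ → ℤ × ℤ) (hS : S ⊆ cuspShell X L)
    (hdata : ∀ x ∈ S, RingOfForm.IsMaximal (orbitRep (O x)) ∧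
      hessAt (orbitRep (O x)) (q x).1 (q x).2 = 9 * x.1 ∧ covAt (orbitRep (O x)) (q x).1 (q x).2 = -54 * x.2 ∧
      (orbitRep (O x)).disc * (orbitRep (O x)).eval (q x).1 (q x).2 ^ 2 = 108 * (x.1 ^ 3 - x.2 ^ 2) ∧
      P X (186624 * L) (orbitRep (O x)) (q x)) :
    S.ncard ≤ totalCount P X (186624 * L) := by
  classical
  set Y' : ℝ := 186624 * L with hY'
  -- `Finset` models of the orbits of discriminant `Δ ≠ 0` and of the counted `P`-slices
  obtain ⟨orbFin, horb⟩ : ∃ f : (Δ : ℤ) → Finset (orbitsOfDisc Δ), ∀ Δ, Δ ≠ 0 → ∀ O, O ∈ f Δ :=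
    ⟨fun Δ => if hΔ : Δ = 0 then ∅ else (@Set.finite_univ (orbitsOfDisc Δ) (finite_orbitsOfDisc hΔ)).toFinset,
      fun Δ hΔ O => by simp only [dif_neg hΔ, Set.Finite.mem_toFinset, Set.mem_univ]⟩
  obtain ⟨shellFin, hcard, hmemS⟩ : ∃ g : (Δ : ℤ) → orbitsOfDisc Δ → Finset (ℤ × ℤ),
      (∀ Δ, Δ ≠ 0 → ∀ O, shellCount P X Y' (orbitRep O) = (g Δ O).card) ∧
      (∀ Δ (_ : Δ ≠ 0) O q, RingOfForm.IsMaximal (orbitRep O) → q ∈ ifShell (orbitRep O) X Y' →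
        P X Y' (orbitRep O) q → q ∈ g Δ O) :=
    ⟨fun Δ O => if hΔ : Δ = 0 then ∅ else (shellSetP_finite hΔ O P X Y').toFinset,
      fun Δ hΔ O => by simp only [dif_neg hΔ]; exact Set.ncard_eq_toFinset_card _ (shellSetP_finite hΔ O P X Y'),
      fun Δ hΔ O q h1 h2 h3 => by simp only [dif_neg hΔ, Set.Finite.mem_toFinset]; exact ⟨h1, h2, h3⟩⟩
  let U : Finset (Σ Δ : ℤ, Σ _ : orbitsOfDisc Δ, ℤ × ℤ) :=
    ((Finset.Icc (-(⌈2 * Y'⌉₊ : ℤ)) (⌈2 * Y'⌉₊ : ℤ)).erase 0).sigma fun Δ => (orbFin Δ).sigma fun O => shellFin Δ O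
  have hU : U.card = totalCount P X Y' := by
    rw [Finset.card_sigma]; unfold totalCount
    refine Finset.sum_congr rfl fun Δ hΔ => ?_
    have hΔ0 : Δ ≠ 0 := (Finset.mem_erase.mp hΔ).1
    rw [Finset.card_sigma]; unfold orbitTotal
    rw [finsum_eq_finsetSum_of_support_subset _ (fun O _ => Finset.mem_coe.mpr (horb Δ hΔ0 O))]
    exact Finset.sum_congr rfl fun O _ => (hcard Δ hΔ0 O).symm
  let Φ : ℤ × ℤ → (Σ Δ : ℤ, Σ _ : orbitsOfDisc Δ, ℤ × ℤ) := fun x => ⟨D x, O x, q x⟩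
  have hmem : ∀ x ∈ S, Φ x ∈ (U : Set _) := by
    intro x hxS
    have hx : x ∈ cuspShell X L := hS hxS
    obtain ⟨hmax, hH, hG, hDF, hP⟩ := hdata x hxS
    have hdisc : (orbitRep (O x)).disc = D x := (orbitRep_spec (O x)).2
    have hq : q x ∈ ifShell (orbitRep (O x)) X Y' := mem_ifShell_of_data hx hH hG hDF
    have hD0 : D x ≠ 0 := by
      rw [← hdisc]; refine left_ne_zero_of_mul (b := (orbitRep (O x)).eval (q x).1 (q x).2 ^ 2) ?_
      rw [hDF]; exact mul_ne_zero (by norm_num) (sub_ne_zero.mpr hx.2.2.1)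
    have hDle : (D x).natAbs ≤ ⌈2 * Y'⌉₊ := by
      have hlt : (Mplus (orbitRep (O x)) (q x) : ℝ) < 2 * Y' := hq.2.2.2.2.2.1
      have hM : Mplus (orbitRep (O x)) (q x) ≤ ⌈2 * Y'⌉₊ := by exact_mod_cast hlt.le.trans (Nat.le_ceil _)
      refine le_trans ?_ ((le_max_left _ _).trans hM)
      rw [show (D x).natAbs = (orbitRep (O x)).disc.natAbs by rw [hdisc], Int.natAbs_mul, Int.natAbs_pow]
      exact Nat.le_mul_of_pos_right _ (pow_pos (Int.natAbs_pos.mpr hq.1) 2)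
    refine Finset.mem_coe.mpr (Finset.mem_sigma.mpr ⟨?_, Finset.mem_sigma.mpr
      ⟨horb _ hD0 _, hmemS _ hD0 _ _ hmax hq hP⟩⟩)
    refine Finset.mem_erase.mpr ⟨hD0, Finset.mem_Icc.mpr (abs_le.mp ?_)⟩
    rw [← Int.natCast_natAbs]; exact_mod_cast hDle
  have hinj : Set.InjOn Φ S := by
    intro x₁ hx₁ x₂ hx₂ h
    obtain ⟨-, hH₁, hG₁, -⟩ := hdata x₁ hx₁
    obtain ⟨-, hH₂, hG₂, -⟩ := hdata x₂ hx₂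
    have h' : (orbitRep (O x₁), q x₁) = (orbitRep (O x₂), q x₂) :=
      congrArg (fun s : (Σ Δ : ℤ, Σ _ : orbitsOfDisc Δ, ℤ × ℤ) => (orbitRep s.2.1, s.2.2)) h
    obtain ⟨hF, hq⟩ := Prod.mk.inj h'
    rw [hF, hq] at hH₁ hG₁
    exact Prod.ext (by linarith) (by linarith)
  calc S.ncard ≤ (U : Set _).ncard := Set.ncard_le_ncard_of_injOn Φ hmem hinj (Finset.finite_toSet U)
    _ = U.card := Set.ncard_coe_finset U
    _ = totalCount P X Y' := hU

/-! ## 5. The count and the cone bookkeeping -/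

/-- **Count.** `#{x ∈ cuspSetD X Y : HallRegimeTw Y x} ≤ totalCount (CornerHallTw ε) X (186624·Y/2) +
totalCount (CornerHallTw ε) X (186624·Y)` (two injections of twist-compatible data, one per shell level). -/
theorem ncard_hallTw_le (X Y : ℝ) (hY : 1 ≤ Y) (ε : ℝ) :
    {x : ℤ × ℤ | x ∈ cuspSetD X Y ∧ HallRegimeTw Y x}.ncard ≤
      totalCount (CornerHallTw ε) X (186624 * (Y / 2)) + totalCount (CornerHallTw ε) X (186624 * Y) := by
  choose D O q hspec using exists_twistData Y
  have key : ∀ L : ℝ, Y ≤ 2 * L →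
      {x : ℤ × ℤ | (x ∈ cuspSetD X Y ∧ HallRegimeTw Y x) ∧ x ∈ cuspShell X L}.ncard ≤
        totalCount (CornerHallTw ε) X (186624 * L) := by
    intro L hL
    refine ncard_le_totalCount_of_data _ (CornerHallTw ε) X L D O q (fun x hx => hx.2) fun x hx => ?_
    obtain ⟨⟨hxD, hHall⟩, -⟩ := hx
    have hne : x.1 ^ 3 ≠ x.2 ^ 2 := hxD.2.2.1
    obtain ⟨hmax, hH, hG, hDF, d, hd1, hd2, hb⟩ := hspec x hne hHall
    exact ⟨hmax, hH, hG, hDF, cornerHallTw_of_twistData hL hne hDF hd1 hd2 hb ε X⟩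
  have hfin : {x : ℤ × ℤ | x ∈ cuspSetD X Y ∧ HallRegimeTw Y x}.Finite := sepSet_finite HallRegimeTw X Y hY
  have hsub : {x : ℤ × ℤ | x ∈ cuspSetD X Y ∧ HallRegimeTw Y x} ⊆
      {x | (x ∈ cuspSetD X Y ∧ HallRegimeTw Y x) ∧ x ∈ cuspShell X (Y / 2)} ∪
        {x | (x ∈ cuspSetD X Y ∧ HallRegimeTw Y x) ∧ x ∈ cuspShell X Y} := fun x hx =>
    (cuspShell_or_of_mem_cuspSetD hx.1).elim (fun h => Or.inl ⟨hx, h⟩) (fun h => Or.inr ⟨hx, h⟩)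
  have hfin' : ({x | (x ∈ cuspSetD X Y ∧ HallRegimeTw Y x) ∧ x ∈ cuspShell X (Y / 2)} ∪
      {x | (x ∈ cuspSetD X Y ∧ HallRegimeTw Y x) ∧ x ∈ cuspShell X Y}).Finite :=
    (hfin.subset fun x hx => hx.1).union (hfin.subset fun x hx => hx.1)
  calc {x : ℤ × ℤ | x ∈ cuspSetD X Y ∧ HallRegimeTw Y x}.ncard
      ≤ ({x | (x ∈ cuspSetD X Y ∧ HallRegimeTw Y x) ∧ x ∈ cuspShell X (Y / 2)} ∪
          {x | (x ∈ cuspSetD X Y ∧ HallRegimeTw Y x) ∧ x ∈ cuspShell X Y}).ncard := Set.ncard_le_ncard hsub hfin'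
    _ ≤ {x | (x ∈ cuspSetD X Y ∧ HallRegimeTw Y x) ∧ x ∈ cuspShell X (Y / 2)}.ncard +
          {x | (x ∈ cuspSetD X Y ∧ HallRegimeTw Y x) ∧ x ∈ cuspShell X Y}.ncard := Set.ncard_union_le _ _
    _ ≤ totalCount (CornerHallTw ε) X (186624 * (Y / 2)) + totalCount (CornerHallTw ε) X (186624 * Y) :=
        add_le_add (key (Y / 2) (by linarith)) (key Y (by linarith))

/-- **Cone bookkeeping at one shell level.** The Hall-corner law at `σ` and `ε' = ε/(1 + σ)`, applied at
`(X, 186624·L)` with `L ≤ Y ≤ 2L` on the cone `X³ ≤ 8Y`, `Y ≤ X^σ` of `LawOn`: `1 ≤ Y' = 186624·L`, `X³ ≤ 2Y'`,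
`Y' ≤ 186624·X^σ`, and `(X·Y')^{ε'} ≤ (186624·X^{1+σ})^{ε'} = 186624^{ε'}·X^ε`, `Y'^{−1/6} ≤ Y^{−1/6}`. -/
theorem level_bound {σ ε C₀ X Y L : ℝ} (hσ : 6 < σ) (hε : 0 < ε)
    (hC₀ : ∀ X Y : ℝ, 1 ≤ X → 1 ≤ Y → X ^ 3 ≤ 2 * Y → Y ≤ 186624 * X ^ σ →
      (totalCount (CornerHallTw (ε / (1 + σ))) X Y : ℝ) ≤
        C₀ * (X * Y) ^ (ε / (1 + σ)) * (X * Y ^ (-(1 / 6 : ℝ)) + 1))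
    (hX : 1 ≤ X) (hY : 1 ≤ Y) (hXY : X ^ 3 ≤ 8 * Y) (hYX : Y ≤ X ^ σ) (hL1 : Y ≤ 2 * L) (hL2 : L ≤ Y) :
    (totalCount (CornerHallTw (ε / (1 + σ))) X (186624 * L) : ℝ) ≤
      max C₀ 0 * (186624 : ℝ) ^ (ε / (1 + σ)) * X ^ ε * (X * Y ^ (-(1 / 6 : ℝ)) + 1) := by
  have hX0 : 0 < X := by linarith
  have hY0 : 0 < Y := by linarith
  have hL0 : 0 < L := by linarith
  have hσ1 : 0 < 1 + σ := by linarith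
  have hε' : 0 < ε / (1 + σ) := div_pos hε hσ1
  have hY'1 : 1 ≤ 186624 * L := by linarith
  have hY'Y : Y ≤ 186624 * L := by linarith
  have hc1 : X ^ 3 ≤ 2 * (186624 * L) := by linarith
  have hc2 : 186624 * L ≤ 186624 * X ^ σ := by linarith [hL2.trans hYX]
  have h1 := hC₀ X (186624 * L) hX hY'1 hc1 hc2
  have e1 : (X * (186624 * L)) ^ (ε / (1 + σ)) ≤ (186624 : ℝ) ^ (ε / (1 + σ)) * X ^ ε := by
    have hle : X * (186624 * L) ≤ 186624 * X ^ (1 + σ) := by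
      rw [Real.rpow_add hX0, Real.rpow_one]
      have := mul_le_mul_of_nonneg_left hc2 hX0.le
      linarith
    calc (X * (186624 * L)) ^ (ε / (1 + σ)) ≤ (186624 * X ^ (1 + σ)) ^ (ε / (1 + σ)) :=
          Real.rpow_le_rpow (by positivity) hle hε'.le
      _ = (186624 : ℝ) ^ (ε / (1 + σ)) * (X ^ (1 + σ)) ^ (ε / (1 + σ)) :=
          Real.mul_rpow (by norm_num) (by positivity)
      _ = (186624 : ℝ) ^ (ε / (1 + σ)) * X ^ ε := by
          rw [← Real.rpow_mul hX0.le]; congr 2; field_simp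
  have e2 : (186624 * L) ^ (-(1 / 6 : ℝ)) ≤ Y ^ (-(1 / 6 : ℝ)) :=
    Real.rpow_le_rpow_of_nonpos hY0 hY'Y (by norm_num)
  have hE : 0 ≤ (X * (186624 * L)) ^ (ε / (1 + σ)) := Real.rpow_nonneg (by positivity) _
  have hA : 0 ≤ X * (186624 * L) ^ (-(1 / 6 : ℝ)) + 1 := by positivity
  have hA' : X * (186624 * L) ^ (-(1 / 6 : ℝ)) + 1 ≤ X * Y ^ (-(1 / 6 : ℝ)) + 1 := by
    nlinarith [mul_le_mul_of_nonneg_left e2 hX0.le]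
  have hB : 0 ≤ X * Y ^ (-(1 / 6 : ℝ)) + 1 := by positivity
  calc (totalCount (CornerHallTw (ε / (1 + σ))) X (186624 * L) : ℝ)
      ≤ C₀ * (X * (186624 * L)) ^ (ε / (1 + σ)) * (X * (186624 * L) ^ (-(1 / 6 : ℝ)) + 1) := h1
    _ ≤ max C₀ 0 * (X * (186624 * L)) ^ (ε / (1 + σ)) * (X * Y ^ (-(1 / 6 : ℝ)) + 1) :=
        mul_le_mul (mul_le_mul_of_nonneg_right (le_max_left _ _) hE) hA' hA (mul_nonneg (le_max_right _ _) hE)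
    _ ≤ max C₀ 0 * ((186624 : ℝ) ^ (ε / (1 + σ)) * X ^ ε) * (X * Y ^ (-(1 / 6 : ℝ)) + 1) :=
        mul_le_mul_of_nonneg_right (mul_le_mul_of_nonneg_left e1 (le_max_right _ _)) hB
    _ = max C₀ 0 * (186624 : ℝ) ^ (ε / (1 + σ)) * X ^ ε * (X * Y ^ (-(1 / 6 : ℝ)) + 1) := by ring

/-! ## 6. The cross-line identification -/

/-- **The Hall-corner law implies the sibling's twist-aware Hall regime law** (registered sub-goal
`lawOn_hallRegimeTw_of_cornerHallLaw6` of stmt-ABC-1975; cross-line identification of the open stub `stub_cornerHall`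
of line `unit-plane-conic-two-torsion` with the open Hall stub of line `deep-moduli-cusp-dispersion`): if
`CornerHallLaw6 = LawWithConeE CornerHallTw 1` holds then `LawOn HallRegimeTw`, with constant
`2·max(C₀, 0)·186624^{ε/(1+σ)}` from the corner law's constant `C₀` at `(σ, ε/(1+σ))`. Proof: the twist-compatible
dictionary (`exists_twistData`) sends a Hall-regime pair of `cuspSetD X Y` injectively to a Hall-corner datum of the
index-form shell at level `93312Y` or `186624Y` (`ncard_hallTw_le`), and the cone bookkeeping is `level_bound`. -/
theorem lawOn_hallRegimeTw_of_cornerHallLaw6 : CornerHallLaw6 → Summit.ABC.ABC.Theorems.SharpModerateLaw.CuspDispersion.LawOn Summit.ABC.ABC.Theorems.SharpModerateLaw.CuspDispersion.HallRegimeTw := by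
  intro hlaw σ hσ ε hε
  obtain ⟨C₀, hC₀⟩ := hlaw σ hσ (ε / (1 + σ)) (div_pos hε (by linarith))
  refine ⟨2 * (max C₀ 0 * (186624 : ℝ) ^ (ε / (1 + σ))), fun X Y hX hY hXY hYX => ?_⟩
  have b1 := level_bound hσ hε hC₀ hX hY hXY hYX (show Y ≤ 2 * (Y / 2) by linarith) (show Y / 2 ≤ Y by linarith)
  have b2 := level_bound hσ hε hC₀ hX hY hXY hYX (show Y ≤ 2 * Y by linarith) le_rfl
  calc (Set.ncard {x : ℤ × ℤ | x ∈ cuspSetD X Y ∧ HallRegimeTw Y x} : ℝ)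
      ≤ (totalCount (CornerHallTw (ε / (1 + σ))) X (186624 * (Y / 2)) : ℝ) +
          (totalCount (CornerHallTw (ε / (1 + σ))) X (186624 * Y) : ℝ) := by
        exact_mod_cast ncard_hallTw_le X Y hY (ε / (1 + σ))
    _ ≤ max C₀ 0 * (186624 : ℝ) ^ (ε / (1 + σ)) * X ^ ε * (X * Y ^ (-(1 / 6 : ℝ)) + 1) +
          max C₀ 0 * (186624 : ℝ) ^ (ε / (1 + σ)) * X ^ ε * (X * Y ^ (-(1 / 6 : ℝ)) + 1) := add_le_add b1 b2
    _ = 2 * (max C₀ 0 * (186624 : ℝ) ^ (ε / (1 + σ))) * X ^ ε * (X * Y ^ (-(1 / 6 : ℝ)) + 1) := by ring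

/-- The same, curried (corollary form). -/
theorem lawOn_hallRegimeTw_of_cornerHallLaw6' (h : CornerHallLaw6) : LawOn HallRegimeTw :=
  lawOn_hallRegimeTw_of_cornerHallLaw6 h

end Summit.ABC.ABC.Theorems.SharpModerateLaw.UnitPlane

end
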